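import Literature.Probability.Percolation.TrackExchangeBlock
import Literature.Probability.Percolation.GrowthProcessDomination
import HarnessLib

/-!
# One block of track exchanges: the one-step growth inequality (GM14 Lemma 6.6)

Grimmett–Manolescu, *Bond percolation on isoradial graphs* (PTRF 159 (2014) 273–327 =
arXiv:1204.0505), §6.2, Lemma 6.6 (6.15): "there exists `η = η(ε) ∈ (0,1)` and a family of
independent Bernoulli random variables `(Y_n^k)` with common parameter `η` such that
`H_n^{k+1} ≤ max{C(H^k)_n, H_n^k + Y_n^k}`", where `H^k_n = h(γ^k ∩ col_{n+d_k})` are the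
shifted column heights of the transported path and `C` is the covering by mountains.

This file proves the **deterministic core** of Lemma 6.6 for one block
(`Literature.Probability.Percolation.TrackExchangeBlock`): with `W₀` the walk at the start of the
block, `W'` the walk at its end, `G c` / `G' c` their column heights (`colmax`) and `d` the
current shift,

* `BlockData.Ydet W₀ r c` — **the designated detour event of column `c`**: the detour event
  (`ExchangeData.DetourAt`) of the sweep whose level is the height `G c`, at column `c`
  (GM14: "`Σ_l` is the final track-exchange with the potential to add vertices to the path at
  height `l+1` […] the height in `col_{n+1}` increases only if the secondary outcome occurs");
* **`BlockData.growth_dichotomy`** — for every column `c`, either `G' (c+1)` is below a mountain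
  `mountain l (G (l + d)) (c - d)` of the old shifted range, or `Ydet W₀ r c` holds and
  `G' (c+1) ≤ G c + 1`. In the shifted frame `H' n = G' (n + d + 1)`, `H n = G (n + d)` this is
  exactly the hypothesis `hstep` of `GrowthProcess.le_process_of_forall_step` (GM14 (6.15) with
  `C(H)_n = max_l mountain l (H l) n`).

The proof is a case analysis of the provenance (`BlockData.Gen`) of a highest label of `W'` in
column `c+1` against the envelope `Bounded` at the sweep that generated it, using the parity of
primal labels; the detour case at the level `G c` is the only one not covered by a mountain —
GM14's (6.26)–(6.28).

## References

* G. R. Grimmett, I. Manolescu, PTRF 159 (2014) 273–327, arXiv:1204.0505, §6.2, Lemma 6.6 and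
  its proof ((6.23), (6.26)–(6.28)).
-/

noncomputable section

namespace Literature.Probability.Percolation

open LatticeModels StarTriangle Real GrowthProcess

namespace TrackExchange

/-! ### Column heights of a walk -/

/-- The heights of the labels of `W` in column `c`. [folklore] -/
def heights (W : List SV) (c : ℤ) : List ℤ :=
  W.filterMap fun z => z.bind fun p => if p.1 = c then some p.2 else none

/-- Membership in the list of heights. [folklore] -/
theorem mem_heights_iff {W : List SV} {c y : ℤ} : y ∈ heights W c ↔ some (c, y) ∈ W := by
  unfold heights
  rw [List.mem_filterMap]
  constructor
  · rintro ⟨z, hz, h⟩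
    rcases z with _ | ⟨m, y'⟩
    · simp at h
    · simp only [Option.bind_some] at h
      by_cases hm : m = c
      · rw [if_pos hm] at h
        simp only [Option.some.injEq] at h
        rw [← h, ← hm]; exact hz
      · rw [if_neg hm] at h
        exact absurd h (by simp)
  · intro h
    exact ⟨some (c, y), h, by simp⟩

/-- **The height of a walk in a column** (`-∞` if the column is not visited; GM14's `h^k_n`).
[cite: GrimmettManolescu2014Isoradial, §6.2] -/
def colmax (W : List SV) (c : ℤ) : WithBot ℤ := (heights W c).maximum

/-- A label is below the height of its column. [folklore] -/
theorem le_colmax {W : List SV} {c y : ℤ} (h : some (c, y) ∈ W) : (y : WithBot ℤ) ≤ colmax W c :=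
  List.le_maximum_of_mem' (mem_heights_iff.2 h)

/-- A finite column height is attained. [folklore] -/
theorem mem_of_colmax_eq {W : List SV} {c l : ℤ} (h : colmax W c = l) : some (c, l) ∈ W :=
  mem_heights_iff.1 (List.maximum_eq_coe_iff.1 h).1

/-- The column height is `-∞` or attained. [folklore] -/
theorem colmax_eq_bot_or (W : List SV) (c : ℤ) : colmax W c = ⊥ ∨ ∃ l : ℤ, colmax W c = l ∧ some (c, l) ∈ W := by
  rcases h : colmax W c with _ | l
  · exact Or.inl rfl
  · exact Or.inr ⟨l, rfl, mem_of_colmax_eq h⟩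

/-- Bounding a column height by bounding its labels. [folklore] -/
theorem colmax_le {W : List SV} {c : ℤ} {b : WithBot ℤ} (h : ∀ y, some (c, y) ∈ W → (y : WithBot ℤ) ≤ b) :
    colmax W c ≤ b :=
  List.maximum_le_of_forall_le fun y hy => h y (mem_heights_iff.1 hy)

/-! ### The one-step growth inequality -/

namespace BlockData

variable (B : BlockData)

/-- **The designated detour event of column `c`** for the block started from the walk `W₀`
with noise `r`: the column is visited, its height `G c` is the level of some sweep `s` of the
block, `(c, G c)` is a primal label, and the detour event of that sweep at column `c` occurs.
(Its probability given the past is at most `rateBound ε`.) [cite: GrimmettManolescu2014Isoradial, §6.2 proof of Lemma 6.6] -/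
def Ydet (W₀ : List SV) (r : ℕ → B.Noise) (c : ℤ) : Prop :=
  ∃ s : ℕ, s < B.N ∧ Even (c + B.level s) ∧ (B.level s : WithBot ℤ) = colmax W₀ c ∧ (B.D s).DetourAt (r s).2 c

variable {B}

/-- `WithBot` arithmetic: `y ≤ h + a` in `ℤ` and `h ≤ G` give `y ≤ G + a`. [folklore] -/
theorem coe_le_add_of_le {y h a : ℤ} {G : WithBot ℤ} (h1 : y ≤ h + a) (h2 : (h : WithBot ℤ) ≤ G) :
    (y : WithBot ℤ) ≤ G + (a : WithBot ℤ) :=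
  calc (y : WithBot ℤ) ≤ ((h + a : ℤ) : WithBot ℤ) := by exact_mod_cast h1
    _ = (h : WithBot ℤ) + (a : WithBot ℤ) := by push_cast; rfl
    _ ≤ G + (a : WithBot ℤ) := by gcongr

/-- A label of `W₀` to the left bounds through its mountain. [folklore] -/
theorem le_mountain_of_mem {W₀ : List SV} {r h c d y : ℤ} (hr : r < c) (hmem : some (r, h) ∈ W₀)
    (hy : y ≤ h - (c - r) + 1) : (y : WithBot ℤ) ≤ mountain (r - d) (colmax W₀ (r - d + d)) (c - d) := by
  unfold mountain
  have hcr : |c - d - (r - d)| = c - r := by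
    rw [show c - d - (r - d) = c - r by ring]; exact abs_of_nonneg (by omega)
  rw [if_neg (by omega), sub_add_cancel, hcr]
  have hy' : y ≤ h + (1 - (c - r)) := hy.trans_eq (by ring)
  exact coe_le_add_of_le hy' (le_colmax hmem)

/-- **The one-step growth dichotomy** (GM14 Lemma 6.6, deterministic core). After a valid block
started from the primal walk `W₀`, for every column `c` and shift `d`: the new height in column
`c + 1` is below a mountain of the old heights (read in the frame shifted by `d`), or the
designated detour event of column `c` holds and the new height is at most the old height of
column `c` plus one. [cite: GrimmettManolescu2014Isoradial, §6.2 Lemma 6.6] -/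
theorem growth_dichotomy {W₀ : List SV} {P₀ P₁ : SV} {r : ℕ → B.Noise} {x' : ExchangeData.WState}
    (hpar₀ : ∀ m h, some (m, h) ∈ W₀ → Even (m + h)) (hinv : B.BlockInv W₀ P₀ P₁ r B.N x') (c d : ℤ) :
    (∃ l, colmax x'.2 (c + 1) ≤ mountain l (colmax W₀ (l + d)) (c - d)) ∨
      (B.Ydet W₀ r c ∧ colmax x'.2 (c + 1) ≤ colmax W₀ c + 1) := by
  rcases colmax_eq_bot_or x'.2 (c + 1) with hbot | ⟨y, hy, hmem⟩
  · exact Or.inl ⟨c - d, by rw [hbot]; exact bot_le⟩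
  rw [hy]
  have hlevN : B.level B.N = B.b - 1 := by simp only [level]; ring
  have hpar := hinv.parity _ _ hmem
  -- mountains in the shifted frame
  have mtn_self : ∀ {y' : ℤ}, (y' : WithBot ℤ) ≤ colmax W₀ c →
      ∃ l, (y' : WithBot ℤ) ≤ mountain l (colmax W₀ (l + d)) (c - d) := fun {y'} h =>
    ⟨c - d, by unfold mountain; rw [if_pos rfl, sub_add_cancel]; exact h⟩
  have mtn_right : ∀ {y' : ℤ}, (y' : WithBot ℤ) ≤ colmax W₀ (c + 1) →
      ∃ l, (y' : WithBot ℤ) ≤ mountain l (colmax W₀ (l + d)) (c - d) := fun {y'} h =>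
    ⟨c + 1 - d, by
      unfold mountain
      rw [if_neg (by omega), sub_add_cancel, show |c - d - (c + 1 - d)| = 1 by
        rw [show c - d - (c + 1 - d) = -1 by ring]; norm_num]
      simpa using h⟩
  have mtn_left : ∀ {y' r h : ℤ}, r < c → some (r, h) ∈ W₀ → y' ≤ h - (c - r) + 1 →
      ∃ l, (y' : WithBot ℤ) ≤ mountain l (colmax W₀ (l + d)) (c - d) := fun {y' r h} hr hmem hy =>
    ⟨r - d, le_mountain_of_mem hr hmem hy⟩
  rcases hinv.prov _ hmem with h0 | ⟨s, hs, m, y', he, hg⟩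
  · -- an original label
    exact Or.inl (mtn_right (le_colmax h0))
  simp only [Option.some.injEq, Prod.mk.injEq] at he
  obtain ⟨rfl, rfl⟩ := he
  rcases hg with ⟨rfl, hb, hp⟩ | ⟨rfl, hb, hp⟩ | ⟨rfl, hb, hp, hdet⟩
  · -- generated as the new middle vertex `(c+1, J_s)` from `(c-1, J_s)`
    left
    rcases hb with ⟨h, h1, h2⟩ | ⟨r', h, h1, h2, h3, h4⟩
    · rw [show c + 1 - 2 = c - 1 by ring] at h1
      exact mtn_left (by omega) h1 (by omega)
    · have hp' := hpar₀ _ _ h1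
      have hne : B.level s ≠ h - (c + 1 - 2 - r') + 1 := by
        intro he; obtain ⟨a, ha⟩ := hp'; obtain ⟨e, he'⟩ := hpar; omega
      exact mtn_left (by omega) h1 (by omega)
  · -- generated as the lower detour `(c+1, J_s - 1)` from `(c, J_s)`
    left
    rcases hb with ⟨h, h1, h2⟩ | ⟨r', h, h1, h2, h3, h4⟩
    · rw [show c + 1 - 1 = c by ring] at h1
      exact mtn_self ((WithBot.coe_le_coe.2 (by omega)).trans (le_colmax h1))
    · exact mtn_left (by omega) h1 (by omega)
  · -- generated as the upper detour `(c+1, J_s + 1)` from `(c, J_s)`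
    rcases hb with ⟨h, h1, h2⟩ | ⟨r', h, h1, h2, h3, h4⟩
    · rw [show c + 1 - 1 = c by ring] at h1 hdet
      rcases colmax_eq_bot_or W₀ c with hbot | ⟨G, hG, -⟩
      · exact absurd (le_colmax h1) (by rw [hbot]; simp)
      have hhG : h ≤ G := by have := le_colmax h1; rw [hG] at this; exact_mod_cast this
      by_cases hlt : B.level s < G
      · exact Or.inl (mtn_self (by rw [hG]; exact_mod_cast (by omega)))
      · -- the peak case: the generating label is the top of column `c`, at the level of the sweep
        have heq : B.level s = G := by omega
        right
        refine ⟨⟨s, hs, by rw [show c + 1 - 1 = c by ring] at hp; exact hp, by rw [hG, heq], hdet⟩, ?_⟩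
        rw [hG, heq]
        exact_mod_cast le_rfl
    · rw [show c + 1 - 1 = c by ring] at h2 h3 h4
      have hp' := hpar₀ _ _ h1
      have hne : B.level s ≠ h - (c - r') + 1 := by
        intro he; obtain ⟨a, ha⟩ := hp'; obtain ⟨e, he'⟩ := hpar; omega
      exact Or.inl (mtn_left (by omega) h1 (by omega))

end BlockData

end TrackExchange

end Literature.Probability.Percolation
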